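import Mathlib
import HarnessLib
import Summits.QuantumAdvantage.QuantumAdvantage.Theses.SpikesNeedAddresses

/-!
# Birth skeleton — piece `PromiseOracleElimination` of the `PromiseTransfer` split (stmt-QuantumAdvantage-10749 / -11702)

PROMISE-BPP' ORACLE ELIMINATION relative to a random oracle, cut into its two ingredients:

* `stub_promiseBPP'_amplification` (M): error reduction for the TEXTBOOK promise class with the error exponent
  `m` appended in unary — from the `2/3` gap of `PromiseBPP'` to error `≤ 2^(-m)` with `p(|v| + m)` coins, by the
  majority of `O(m)` independent runs (Chernoff/Hoeffding); nothing is demanded off the promise;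
* `stub_farCoinSimulation` (L): for ANY promise problem with such an amplified `P`-decider, every deterministic
  poly-time transcript machine `C` with oracle `A ⊕ g` is reproduced, output for output and for EVERY `A`, by a
  deterministic poly-time `C'` with oracle `A` alone that answers `C`'s `g`-queries `true :: v` (`|v| < q(n)`) by the
  amplified decider run on coins READ OFF the oracle at an injective family of addresses `addr(v, t, j)` of one fixed
  length `> ℓ(n)` (the finite far window `V`); `ĝ(A)` := these simulated answers on short `v`, the correct answers
  elsewhere, so `ĝ(A) = ĝ(A ∩ V)`; with `m := q(n) + 1 + ⌈log₂(r(n)+1)⌉` the union bound over the `≤ 2^(q(n)+1)` short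
  promise instances bounds the inconsistency event by `1/(r(n)+1)`.

Composition `PromiseOracleElimination_of` is function application (the piece quantifies `∀ Q ∈ PromiseBPP'`).
-/

set_option linter.dupNamespace false

namespace Summit.QuantumAdvantage.QuantumAdvantage.Cruxes.PromiseTransfer.BirthPromiseOracleElimination

open Literature.Computability.Complexity Literature.Computability.Cryptography

/-- The piece, verbatim as filed. -/
def PromiseOracleElimination : Prop :=
  ∀ Q ∈ Literature.Computability.Complexity.PromiseBPP', ∀ (C : OracleAlg Bool) (q : Polynomial ℕ),
    C.IsPolyTime Computability.encodingBoolBool →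
    (∀ (O : Oracle) (x : List Bool), ∀ y ∈ C.queries O (q.eval x.length) x, y.length ≤ q.eval x.length) →
    ∀ ℓ r : Polynomial ℕ, ∃ (C' : OracleAlg Bool) (q' : Polynomial ℕ),
      C'.IsPolyTime Computability.encodingBoolBool ∧
      (∀ (A : Language Bool) (x : List Bool), ∀ y ∈ C'.queries (Oracle.ofLanguage A) (q'.eval x.length) x, y.length ≤ q'.eval x.length) ∧
      ∀ x : List Bool, 1 ≤ x.length →
        ∃ (V : Finset (List Bool)) (ĝ : Set (List Bool) → (List Bool → Bool)),
          (∀ v ∈ V, ℓ.eval x.length < v.length) ∧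
          (∀ A : Set (List Bool), ĝ A = ĝ (A ∩ ↑V)) ∧
          (∀ (A : Set (List Bool)) (b : Bool),
            C.run (Oracle.ofLanguage {w : List Bool | ∃ v : List Bool, (w = false :: v ∧ v ∈ A) ∨ (w = true :: v ∧ ĝ A v = true)}) (q.eval x.length) x = some b →
            C'.run (Oracle.ofLanguage A) (q'.eval x.length) x = some b) ∧
          (ProbabilityTheory.setBernoulli (Set.univ : Set (List Bool)) ⟨1 / 2, by norm_num, by norm_num⟩)
            {A : Set (List Bool) | ¬ ((∀ v ∈ Q.yes, ĝ A v = true) ∧ (∀ v ∈ Q.no, ĝ A v = false))}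
            ≤ ENNReal.ofReal (1 / (((r.eval x.length : ℕ) : ℝ) + 1))

/-- `(L', p)` is an AMPLIFIED decider of `Q`: with the error exponent `m` appended in unary, it errs on the promise
with probability `≤ 2^(-m)` over `p(|v| + m)` coins. -/
def AmplifiedDecider (Q : PromiseProblem) (L' : Language Bool) (p : Polynomial ℕ) : Prop :=
  ∀ m : ℕ,
    (∀ v ∈ Q.yes, 1 - (1 / 2 : ℝ) ^ m ≤
      Literature.Computability.Complexity.uniformProb (p.eval (v.length + m))
        {y : List Bool | Literature.Computability.Complexity.boolPair (Literature.Computability.Complexity.boolPair v (List.replicate m true)) y ∈ L'}) ∧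
    (∀ v ∈ Q.no, 1 - (1 / 2 : ℝ) ^ m ≤
      Literature.Computability.Complexity.uniformProb (p.eval (v.length + m))
        {y : List Bool | Literature.Computability.Complexity.boolPair (Literature.Computability.Complexity.boolPair v (List.replicate m true)) y ∉ L'})

/-- The conclusion of the piece for ONE promise problem `Q` (verbatim the body of `PromiseOracleElimination`). -/
def EliminationFor (Q : PromiseProblem) : Prop :=
  ∀ (C : OracleAlg Bool) (q : Polynomial ℕ),
    C.IsPolyTime Computability.encodingBoolBool →
    (∀ (O : Oracle) (x : List Bool), ∀ y ∈ C.queries O (q.eval x.length) x, y.length ≤ q.eval x.length) →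
    ∀ ℓ r : Polynomial ℕ, ∃ (C' : OracleAlg Bool) (q' : Polynomial ℕ),
      C'.IsPolyTime Computability.encodingBoolBool ∧
      (∀ (A : Language Bool) (x : List Bool), ∀ y ∈ C'.queries (Oracle.ofLanguage A) (q'.eval x.length) x, y.length ≤ q'.eval x.length) ∧
      ∀ x : List Bool, 1 ≤ x.length →
        ∃ (V : Finset (List Bool)) (ĝ : Set (List Bool) → (List Bool → Bool)),
          (∀ v ∈ V, ℓ.eval x.length < v.length) ∧
          (∀ A : Set (List Bool), ĝ A = ĝ (A ∩ ↑V)) ∧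
          (∀ (A : Set (List Bool)) (b : Bool),
            C.run (Oracle.ofLanguage {w : List Bool | ∃ v : List Bool, (w = false :: v ∧ v ∈ A) ∨ (w = true :: v ∧ ĝ A v = true)}) (q.eval x.length) x = some b →
            C'.run (Oracle.ofLanguage A) (q'.eval x.length) x = some b) ∧
          (ProbabilityTheory.setBernoulli (Set.univ : Set (List Bool)) ⟨1 / 2, by norm_num, by norm_num⟩)
            {A : Set (List Bool) | ¬ ((∀ v ∈ Q.yes, ĝ A v = true) ∧ (∀ v ∈ Q.no, ĝ A v = false))}
            ≤ ENNReal.ofReal (1 / (((r.eval x.length : ℕ) : ℝ) + 1))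

/-- STUB 1 (M, provable now): amplification of textbook promise-BPP with a unary error parameter. -/
theorem stub_promiseBPP'_amplification :
    ∀ Q ∈ Literature.Computability.Complexity.PromiseBPP',
      ∃ L' ∈ Literature.Computability.Complexity.Classes.P, ∃ p : Polynomial ℕ, AmplifiedDecider Q L' p := by
  sorry

/-- STUB 2 (L, provable now): far-coin simulation — an amplified `P`-decider of `Q` lets a deterministic machine with the
random oracle alone reproduce every run of `C^(A ⊕ ĝ(A))`, `ĝ(A)` reading only a far finite window and being
inconsistent with `Q` on measure `≤ 1/(r(n)+1)`. No hypothesis on `Q` beyond the decider (in particular no disjointness: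
an inconsistent promise is simply never met). -/
theorem stub_farCoinSimulation :
    ∀ Q : PromiseProblem,
      (∃ L' ∈ Literature.Computability.Complexity.Classes.P, ∃ p : Polynomial ℕ, AmplifiedDecider Q L' p) →
        EliminationFor Q := by
  sorry

/-- COMPOSITION (no sorry): the two stubs give the piece. -/
theorem PromiseOracleElimination_of
    (h₁ : ∀ Q ∈ Literature.Computability.Complexity.PromiseBPP',
      ∃ L' ∈ Literature.Computability.Complexity.Classes.P, ∃ p : Polynomial ℕ, AmplifiedDecider Q L' p)
    (h₂ : ∀ Q : PromiseProblem,
      (∃ L' ∈ Literature.Computability.Complexity.Classes.P, ∃ p : Polynomial ℕ, AmplifiedDecider Q L' p) →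
        EliminationFor Q) :
    PromiseOracleElimination :=
  fun Q hQ => h₂ Q (h₁ Q hQ)

/-- The piece from the stubs. -/
theorem promiseOracleElimination_holds_of_stubs : PromiseOracleElimination :=
  PromiseOracleElimination_of stub_promiseBPP'_amplification stub_farCoinSimulation

end Summit.QuantumAdvantage.QuantumAdvantage.Cruxes.PromiseTransfer.BirthPromiseOracleElimination
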